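import Literature.AlgebraicGeometry.ShimuraVarieties.UnitaryCurveAuxiliaryTorusLegLattice      -- ★ p850466…p850531 (LA5-p02): (K)∕(t3)∕(t5)∕ε at the torus leg, §8 adapters
import Literature.AlgebraicGeometry.ModuliOfAbelianVarieties.SymplecticLiftOfCoveredFibre       -- ★ p850796 (LA5-p02): `exists_isLambdaOfAt_symplecticLift_of_cover_of_symplecticLift`
import HarnessLib

/-!
# The symplectic lift of the TWISTED fibre at the torus leg `r := r′·ũ_β(1,z)`: `Θ₂`, `IsLambdaOfAt`, `Λ₂` and its tower reading (DEAL #41, (B1) tower)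

Topic `AlgebraicGeometry/ShimuraVarieties`; namespace `Literature.AlgebraicGeometry.ShimuraVarieties.UnitaryCurve.AuxV`.  THEOREMS ONLY (no definition, no named fact,
no instance, no notation, no `sorry`).  Cell `hodgecm-mathlib` (D-0151), FLOOR 0, P6 «MOD programme» (crux hLiu418 = stmt-HodgeConjecture-24832, `--supports`,
count-neutral); line «L4», (S8) sheet-line closer `Lines/F0_P6a_StubESHEET.lean`, road (γ′) «Serre tensor over `X`, classified»; organ **DEAL #41 «(B1) FIBRE LIFT AT THE
SPECIAL SHEET POINTS OF THE TWISTED TUPLE» — TOWER** (LA4-plan (g2) 2026-09-02 09:09:56Z; 09:11:38Z (b) «Θ₂∕Λ₂ + hΛ₂ at the marked fibre»; consumers LA7-p01 (g4) (B1),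
LA6-p02 (g3) (R-CM-3), with DEAL #42 (LA4-p03 (g3)) supplying the marking `m₂` of the twisted fibre).

THE MATHEMATICS ([Shimura1998] §18.6: `A ⊗ 𝔞⁻¹ = ℂ^g ∕ 𝔞⁻¹Λ` and the level structure moves by the idèle `z`, `[z] = 𝔞⁻¹`; [Lan2013PELCompactifications] Lemma 1.3.6.5:
the symplectic lift at a geometric point; [Milne2005ShimuraVarieties] Thm. 6.11, (63)).  At a complex point `s₀` of the base, let the source fibre `A_{s₀}` be marked by
`[J, r′]` (`m`) with a witness `Θ` of `λ_A` and a symplectic lift `Λ` of the level structure read by `m` through `k·r′⁻¹`, `k ∈ K_δ(N)` (★ σ1-UNPACK p850665), and let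
`c : A → B` be a SURJECTIVE homomorphism over the base with `c ≫ λ_B ≫ c^∨ = λ_A ≫ [ν]` and `σ_{B,i} = σ_{A,i} ≫ c`, whose fibre at `s₀` carries the marking `m₂` by
`[J′, r′·ũ_β(1,z)]` with `u₂ = c_{s₀} ∘ u` (DEAL #42).  For the torus leg `ũ_β(1,z)` of a frame `β` with `[z] = 𝔞⁻¹`, `(ν) = 𝔞·c𝔞`, `z ≡ 1 (mod N)`, `z z̄ = q`, the five
transfer binders of ★ p850796 are ★ §8: `ν·ũ ∈ M(ẑ)`, `ũ` a similitude with multiplier `q`, `ν q ∈ ẑ^×`, `ũ⁻¹ ≡ 1 (mod N)`.  HENCE (★ p850796): an AMPLE witness `Θ₂` of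
`λ_B` at `s₀` with `IsLambdaOfAt`, and a symplectic lift `Λ₂` of `σ_B(s₀)` for `Θ₂` of type `δ` whose tower is read through `r′·ũ_β(1,z)` by `m₂`.

* **`exists_isLambdaOfAt_symplecticLift_torusLeg`** — the head (LA6-p02 (g3) letters `Θ₂`, `IsLambdaOfAt`, `Λ₂`, `hΛ₂`; LA7-p01 (g4)'s (B1) binder a fortiori).
Budgets: default heartbeats.  HC_CM is proved only modulo the printed citations (2 remaining named inputs hLiu418 24832, h413 24833) until rung 0 closes — count-neutral.

## References
* [Shimura1998] G. Shimura, *Abelian Varieties with Complex Multiplication and Modular Functions* (1998), §18.3 pp. 122–123, §18.6 pp. 124–127.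
* [Lan2013PELCompactifications] K.-W. Lan, *Arithmetic compactifications of PEL-type Shimura varieties* (2013), §1.3.6 Lemma 1.3.6.5 (p. 81), Cor. 1.3.6.7 (p. 82).
* [Milne2005ShimuraVarieties] J. S. Milne, *Introduction to Shimura varieties* (2005), §6 Thm. 6.11 pp. 74–75, §12 (63) p. 116.
* [MumfordFogartyKirwan1994] D. Mumford, J. Fogarty, F. Kirwan, *Geometric Invariant Theory* (3rd ed. 1994), Ch. 6 §2 Definition 6.3 (p. 120).
-/

set_option autoImplicit false

noncomputable section

open CategoryTheory AlgebraicGeometry Matrix NumberField IsDedekindDomain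
open scoped nonZeroDivisors Pointwise
open Literature.AlgebraicGeometry.ModuliOfAbelianVarieties
open Literature.AlgebraicGeometry.Motives (AbelianVariety AlgPoints CartierDivisor)
open Literature.AlgebraicGeometry.AbelianSchemes (AbelianSchemeOver)
open Literature.NumberTheory.Automorphic (integralFiniteAdeles)
open Literature.NumberTheory.Adeles (latticeOfGL)

namespace Literature.AlgebraicGeometry.ShimuraVarieties

namespace UnitaryCurve

namespace AuxV

open Literature.AlgebraicGeometry.ShimuraVarieties.UnitaryCanonicalModel.Aux (ratBasis torusFinAdelic)
open Literature.NumberTheory.Automorphic Literature.NumberTheory.Automorphic.UnitaryGroup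
open Literature.NumberTheory.Automorphic.FiniteAdeleRing (toFractionalIdeal)
open Literature.NumberTheory.GaloisRepresentations (modulusExp)
open Literature.AlgebraicGeometry.AbelianSchemes.AbelianSchemeOver (DualPair)

variable {F : Type} [Field F] [NumberField F] [IsCMField F] {Jstar : Matrix (Fin 2) (Fin 2) F} {ξ : F} {g : ℕ} {δ : Fin g → ℕ}

/-- **(B1)-TOWER AT THE TORUS LEG: the witness `Θ₂`, `IsLambdaOfAt`, and the symplectic lift `Λ₂` of the twisted fibre read through `r′·ũ_β(1,z)` by its marking `m₂`.**
For a surjective homomorphism `c : A → B` of abelian schemes over a base `Y` with `c ≫ λ_B ≫ c^∨ = λ_A ≫ [ν]` and `σ_{B,i} = σ_{A,i} ≫ c`, a complex point `s₀`, a marked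
source fibre `(m, Θ, Λ)` — `m` by `[J, r′]`, `Θ` a witness of `λ_A` at `s₀`, `Λ` a symplectic lift read by `m` through `k·r′⁻¹`, `k ∈ K_δ(N)` (★ σ1-UNPACK's shape) — and the
marking `m₂` of `B_{s₀}` by `[J′, r′·ũ_β(1,z)]` with `u₂ = c_{s₀} ∘ u` (DEAL #42), where `[z] = 𝔞⁻¹`, `(ν) = 𝔞·c𝔞`, `z ≡ 1 (mod N)` and `z z̄ = q`: THERE ARE an ample `Θ₂` with
`IsLambdaOfAt s₀ D_B λ_B Θ₂` and `Λ₂ : σ_B.SymplecticLift s₀ Θ₂ δ` with `(r′ũ)⁻¹ v̂ ≡ x̃∕M ⟹ Λ₂,M(x) = u₂(v)` — ★ p850796 fed by the ★ §8 adapters.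
[cite: Shimura1998, §18.6 pp. 124–127] [cite: Lan2013PELCompactifications, §1.3.6 Lemma 1.3.6.5 (p. 81) and Cor. 1.3.6.7 (p. 82)]
[cite: Milne2005ShimuraVarieties, §6 Thm. 6.11 pp. 74–75 and §12 (63) p. 116] [cite: MumfordFogartyKirwan1994, Ch. 6 §2 Definition 6.3 (p. 120)] -/
theorem exists_isLambdaOfAt_symplecticLift_torusLeg (hδ : IsPolarizationType δ) (hg : 0 < g)
    (Fr : SymplecticFrameV F (RingHom.id F) Jstar ξ g δ)
    (ρ : 𝓞 F →+* Matrix (Fin g ⊕ Fin g) (Fin g ⊕ Fin g) ℤ)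
    (hρ : ∀ b : 𝓞 F, (ρ b).map (Int.cast : ℤ → ℚ) =
      framePV Fr * resMatrix (m := Fin 2) (ratBasis F) (((b : 𝓞 F) : F) • (1 : Matrix (Fin 2) (Fin 2) F)) * frameQV Fr)
    -- the sheet arithmetic: `[z] = 𝔞⁻¹`, `(ν) = 𝔞 · c𝔞`, `z ≡ 1 (mod N)`, `z z̄ = q`
    (z : ↥(torusFinAdelic F)) (𝔞 : Ideal (𝓞 F)) (h𝔞 : 𝔞 ≠ ⊥)
    (hz : toFractionalIdeal (𝓞 F) F (z : (FiniteAdeleRing (𝓞 F) F)ˣ) = ((𝔞 : FractionalIdeal (𝓞 F)⁰ F))⁻¹)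
    {ν : ℕ} (hν : ν ≠ 0) (hνa : Ideal.span {((ν : ℕ) : 𝓞 F)} = 𝔞 * (IsCMField.complexConj F) • 𝔞)
    {N : ℕ} (hN : N ≠ 0)
    (hcong : ∀ v : HeightOneSpectrum (𝓞 F), Ideal.span {((N : ℕ) : 𝓞 F)} ≤ v.asIdeal →
      Valued.v (((z : (FiniteAdeleRing (𝓞 F) F)ˣ) : FiniteAdeleRing (𝓞 F) F) v) = 1 ∧
        Valued.v (((z : (FiniteAdeleRing (𝓞 F) F)ˣ) : FiniteAdeleRing (𝓞 F) F) v - 1) ≤ WithZero.exp (-(modulusExp (Ideal.span {((N : ℕ) : 𝓞 F)}) v : ℤ)))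
    (q : finAdeleQˣ)
    (hq : ((z : (FiniteAdeleRing (𝓞 F) F)ˣ) : FiniteAdeleRing (𝓞 F) F) *
        conjFiniteAdele (↥(maximalRealSubfield F)) F (IsCMField.complexConj F) ((z : (FiniteAdeleRing (𝓞 F) F)ˣ) : FiniteAdeleRing (𝓞 F) F) =
      FiniteAdeleRing.baseChange (𝓞 ℚ) ℚ F (𝓞 F) (q : finAdeleQ))
    -- the cover and its global rows (t3), (t5)
    {Y : Scheme.{0}} {A B : AbelianSchemeOver Y} [IsCommMonObj A.X] (c : A.X ⟶ B.X) [IsMonHom c] [Surjective c.left]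
    (φ : A.LevelStructure g N) (φ' : B.LevelStructure g N) (hφ' : ∀ i, φ'.σ i = φ.σ i ≫ c)
    {D : A.DualPair} {D' : B.DualPair} (pol : A.Polarization D) (pol' : B.Polarization D')
    (ht3 : c ≫ pol'.lam ≫ DualPair.dualIsogenyOver c D D' = pol.lam ≫ D.hat.mulN ν)
    -- the marked source fibre (σ1-UNPACK's shape) and the marking of the twisted fibre (DEAL #42's shape)
    {s₀ : Spec (.of ℂ) ⟶ Y} {J J' : C0pm δ} {r' k : ↥(gspFinAdelic δ)} (hkN : k ∈ principalLevelSubgroup δ N)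
    (Θ : CartierDivisor (A.fibre s₀).toAbelianVariety.X.left) (hΘ : A.IsLambdaOfAt s₀ D pol.lam Θ) (Λ : φ.SymplecticLift s₀ Θ δ)
    (m : SiegelAdelicMarking J r' (A.fibre s₀).toAbelianVariety)
    (hread : ∀ ⦃M : ℕ⦄, N ∣ M → M ≠ 0 → ∀ (x : Fin g ⊕ Fin g → ZMod M) (v : Fin g ⊕ Fin g → ℚ),
      AdelicCongr ((k * r'⁻¹ : ↥(gspFinAdelic δ)) : GL (Fin g ⊕ Fin g) finAdeleQ) 1 v (fun i => ((x i).val : ℚ) / M) →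
        ((Λ.lift M (Multiplicative.ofAdd x)) : (A.fibre s₀).toAbelianVariety.Points ℂ) = m.r v)
    (m₂ : SiegelAdelicMarking J' (r' * auxToGspFinV Fr (1, z)) (B.fibre s₀).toAbelianVariety)
    (hm₂ : ∀ v, m₂.r v = AlgPoints.map (AbelianSchemeOver.fibreHom c s₀).hom.hom.hom (m.r v)) :
    ∃ Θ₂ : CartierDivisor (B.fibre s₀).toAbelianVariety.X.left, Θ₂.IsAmple ∧ B.IsLambdaOfAt s₀ D' pol'.lam Θ₂ ∧
      ∃ Λ₂ : φ'.SymplecticLift s₀ Θ₂ δ,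
        ∀ ⦃M : ℕ⦄, N ∣ M → M ≠ 0 → ∀ (x : Fin g ⊕ Fin g → ZMod M) (v : Fin g ⊕ Fin g → ℚ),
          AdelicCongr (((r' * auxToGspFinV Fr (1, z))⁻¹ : ↥(gspFinAdelic δ)) : GL (Fin g ⊕ Fin g) finAdeleQ) 1 v (fun i => ((x i).val : ℚ) / M) →
            ((Λ₂.lift M (Multiplicative.ofAdd x)) : (B.fibre s₀).toAbelianVariety.Points ℂ) = m₂.r v := by
  -- `ν ∈ 𝔞` from the norm row `(ν) = 𝔞 · c𝔞 ⊆ 𝔞`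
  have hν𝔞 : ((ν : ℕ) : 𝓞 F) ∈ 𝔞 :=
    Ideal.mul_le_right (hνa ▸ Ideal.subset_span (Set.mem_singleton _))
  -- the five transfer binders at the torus leg (★ §8)
  obtain ⟨ε, hε⟩ := exists_units_integralAdeles_eq_natCast_mul_of_torusLeg z 𝔞 hz hν hνa q hq
  exact SiegelAdelicMarking.exists_isLambdaOfAt_symplecticLift_of_cover_of_symplecticLift hδ hg hN hkN φ φ' c hφ' pol pol' hν ht3 Θ hΘ Λ m m₂
    hread hm₂ (natCast_mul_inv_mul_torusLeg_integral Fr ρ hρ r' z 𝔞 h𝔞 hz hν𝔞) (isMultiplier_inv_mul_torusLeg Fr r' z q hq) ε hε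
    (mul_torusLeg_inv_mul_sub_one_of_congr Fr ρ hρ r' z 𝔞 hz hN hcong)

end AuxV

end UnitaryCurve

end Literature.AlgebraicGeometry.ShimuraVarieties

end
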